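import Mathlib
import Literature.NumberTheory.Automorphic.HilbertModularFormQExpansion

/-!
# Spans of a graded multiplicative family of subsets satisfy the engine family axioms

Stub Q1 (`stub_gradedSpan_axioms`) of line Sketch-ideate-r1-k1 of the crux
`HilbertIntegralOverconvergentIsCongruence` (stmt-Langlands-8485).  Section Q of the line shows that
the `p`-adic graded family of the algebraization-engine instance for Hilbert modular forms (the span
of the encoded `q`-expansions of forms of weight `b`) satisfies the engine's five family axioms.
This file is the generic algebra behind it: if `S : ι → Set A` is a family of subsets of a
commutative `K`-algebra `A` indexed by an additive group `ι`, with `1 ∈ S 0` and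
`S b₁ * S b₂ ⊆ S (b₁ + b₂)`, then the `K`-spans `V b := span K (S b)` contain `1` in degree `0`,
contain `0`, are closed under addition and scalars, and satisfy `V b₁ * V b₂ ⊆ V (b₁ + b₂)`.

Proof: the first four axioms are submodule closure properties (`Submodule.subset_span`,
`zero_mem`, `add_mem`, `smul_mem`); for products, `Submodule.mul_mem_mul` puts `φ * ψ` in
`span K (S b₁) * span K (S b₂) = span K (S b₁ * S b₂)` (`Submodule.span_mul_span`), which is
contained in `span K (S (b₁ + b₂))` by `Submodule.span_mono`.
-/

set_option linter.dupNamespace false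

noncomputable section

namespace Summit.Langlands.Langlands.Theorems.HilbertIntegralOverconvergentIsCongruence

open Pointwise

/-- The pointwise product of two members of a graded multiplicative family of subsets lies in the
member of total degree. -/
theorem gsa_mul_subset {ι : Type*} [Add ι] {A : Type*} [Mul A] (S : ι → Set A)
    (hmul : ∀ b₁ b₂ : ι, ∀ x ∈ S b₁, ∀ y ∈ S b₂, x * y ∈ S (b₁ + b₂)) (b₁ b₂ : ι) :
    S b₁ * S b₂ ⊆ S (b₁ + b₂) := by
  rintro _ ⟨x, hx, y, hy, rfl⟩
  exact hmul b₁ b₂ x hx y hy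

/-- **Stub Q1.** The `K`-spans of a graded family of subsets `S : ι → Set A` of a commutative
`K`-algebra, with `1 ∈ S 0` and `S b₁ * S b₂ ⊆ S (b₁ + b₂)`, satisfy the five family axioms of the
algebraization engine: `1 ∈ span K (S 0)`, `0 ∈ span K (S b)`, closure under `+`, closure under
scalars `c : K`, and the graded product rule `span K (S b₁) * span K (S b₂) ⊆ span K (S (b₁ + b₂))`
(stated elementwise, with membership in the underlying sets). -/
theorem stub_gradedSpan_axioms (K : Type) [Field K] (ι : Type) [AddCommGroup ι] (A : Type)
    [CommRing A] [Algebra K A]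
    (S : ι → Set A) (h1 : (1 : A) ∈ S 0)
    (hmul : ∀ b₁ b₂ : ι, ∀ x ∈ S b₁, ∀ y ∈ S b₂, x * y ∈ S (b₁ + b₂)) :
    (1 : A) ∈ (Submodule.span K (S 0) : Set A) ∧ (∀ b, (0 : A) ∈ (Submodule.span K (S b) : Set A)) ∧
      (∀ b (φ ψ : A), φ ∈ (Submodule.span K (S b) : Set A) → ψ ∈ (Submodule.span K (S b) : Set A) →
        φ + ψ ∈ (Submodule.span K (S b) : Set A)) ∧
      (∀ b (c : K) (φ : A), φ ∈ (Submodule.span K (S b) : Set A) →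
        c • φ ∈ (Submodule.span K (S b) : Set A)) ∧
      ∀ b₁ b₂ (φ ψ : A), φ ∈ (Submodule.span K (S b₁) : Set A) →
        ψ ∈ (Submodule.span K (S b₂) : Set A) →
        φ * ψ ∈ (Submodule.span K (S (b₁ + b₂)) : Set A) := by
  refine ⟨Submodule.subset_span h1, fun b => (Submodule.span K (S b)).zero_mem,
    fun b φ ψ hφ hψ => (Submodule.span K (S b)).add_mem hφ hψ,
    fun b c φ hφ => (Submodule.span K (S b)).smul_mem c hφ, fun b₁ b₂ φ ψ hφ hψ => ?_⟩
  have h : φ * ψ ∈ Submodule.span K (S b₁) * Submodule.span K (S b₂) :=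
    Submodule.mul_mem_mul hφ hψ
  rw [Submodule.span_mul_span] at h
  exact Submodule.span_mono (gsa_mul_subset S hmul b₁ b₂) h

end Summit.Langlands.Langlands.Theorems.HilbertIntegralOverconvergentIsCongruence
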